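import Literature.Analysis.FunctionSpaces.TorusClassicalNSUniqueness
import HarnessLib

/-!
# The linearised Navier–Stokes equation along a smooth field on the flat torus, I: energy
# balance, Grönwall bound and uniqueness on a compact time interval

Function-space support file (all results proved; no definitions, no named facts), the LINEAR
twin of `TorusClassicalNSUniqueness`. Fix a jointly smooth velocity field `u` on `[a, b] × T^d`
with divergence-free slices (typically a classical Navier–Stokes solution,
`Torus.IsClassicalNSSolutionOn S ν f u p` of `TorusFluidGlue`). The **linearised Navier–Stokes
equation along `u`** (first variation equation; Constantin–Foias 1988, Ch. 14, (14.3)–(14.4):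
`dv/dt + νAv + B(S(t)u₀, v) + B(v, S(t)u₀) = 0`; Temam 1997, Ch. VI §3.1, (3.7)–(3.10):
`∂ₜU − νΔU + (u·∇)U + (U·∇)u + ∇Π = 0`, `div U = 0`) is, classically and with the one-sided
time derivative `Torus.timeDerivWithin S` of the tree's solution notions,

`∂ₜw + (u·∇)w + (w·∇)u = νΔw − ∇q`, `div w = 0`,

for a jointly smooth pair `(w, q)` on `S × T^d`. No predicate is introduced: every theorem takes
the clauses (joint smoothness of `w` and `q`, incompressibility of the slices of `w`, the
pointwise equation) as separate hypotheses, so that any packaged notion of "linearised solution"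
(e.g. a summit-side `IsLinearizedNSSolutionOn S ν u w q`) feeds them by projection.

## Contents

* `Torus.abs_integral_inner_convect_le` — the production term: `|∫ ⟪(w·∇)v, w⟫| ≤ (∑ᵢ Cᵢ) ∫ ‖w‖²`
  whenever `‖∂ᵢv‖ ≤ Cᵢ` on `T^d`; `Torus.linearisedNS_energy_flux_le` — hence the flux bound
  `−2ν‖∇w‖₂² − 2 ∫ ⟪(w·∇)v, w⟫ ≤ 2(∑ᵢ Cᵢ) ∫ ‖w‖²` for `ν ≥ 0`;
* `Torus.linearisedNS_hasDerivWithinAt_integral_norm_sq` — the **energy identity** on `[a, b]`: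
  `d/dt ∫ ‖w‖² = −2ν ‖∇w‖₂² − 2 ∫ ⟪(w·∇)u, w⟫` within `[a, b]` (the transport term
  `∫ ⟪(u·∇)w, w⟫` and the pressure term vanish by incompressibility of `u` resp. `w`; the viscous
  term is `2ν ∫ ⟪Δw, w⟫ = −2ν ‖∇w‖₂²` by Green);
* `Torus.linearisedNS_integral_norm_sq_le_mul_exp` — **Grönwall**:
  `∫ ‖w(t)‖² ≤ (∫ ‖w(a)‖²) e^{2(∑ᵢ Cᵢ)(t − a)}` on `[a, b]` for bounds `‖∂ᵢu‖ ≤ Cᵢ`;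
* `Torus.linearisedNS_eq_zero`, `Torus.linearisedNS_sub_eq`, `Torus.linearisedNS_unique` —
  **uniqueness** on `[a, b]`: zero datum gives the zero solution; the difference of two linearised
  solutions along the same `u` is a linearised solution (linearity); two solutions with the same
  datum at `t = a` coincide on `[a, b]`.

The sequel `TorusLinearisedNSGrowth` transports these to convex time sets from any anchor, to
integer times on `[0, ∞)` (exponential growth bound = Lyapunov exponents `≤ ∑ᵢ Cᵢ`), and adds the
determination of the pressure gradient by the velocity.

## Proof road

Word for word the energy method of `TorusClassicalNSUniqueness` (there for the difference of two
nonlinear solutions, whose equation is the linearised equation with `u₂` in the production term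
plus the harmless transport by `u₁`): differentiate `∫ ‖w‖²` under the integral
(`Torus.IsSmoothSpaceTimeOn.hasDerivWithinAt_integral`), `∂ₜ‖w‖² = 2⟪∂ₜw, w⟫`, insert the
equation, drop `∫ ⟪(u·∇)w, w⟫ = 0` (`Torus.integral_inner_convect_self_right_eq_zero`) and
`∫ ⟪∇q, w⟫ = 0` (`Torus.integral_inner_gradient_eq_zero_of_isDivFree`), write
`∫ ⟪Δw, w⟫ = −‖∇w‖₂²` (`Torus.integral_inner_laplacian_eq_neg_holds`), bound
`|⟪(w·∇)u, w⟫| ≤ (∑ᵢ Cᵢ)‖w‖²` pointwise, and close with Mathlib's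
`le_gronwallBound_of_liminf_deriv_right_le`. Existence of linearised solutions (Galerkin) is NOT
treated here; neither are `H¹`/parabolic estimates nor backward-in-time statements.

## References

* P. Constantin, C. Foias, *Navier–Stokes Equations*, Chicago Lectures in Math. (1988), Ch. 14,
  (14.2)–(14.6) (the linearised equation along `S(t)u₀`, its solution operator `S'(t, u₀)`,
  uniqueness and the cocycle property). [`ConstantinFoiasNSE1988`]
* R. Temam, *Infinite-Dimensional Dynamical Systems in Mechanics and Physics*, 2nd ed., Springer
  (1997), Ch. VI §3.1, (3.7)–(3.11) (the first variation equation of the Navier–Stokes flow and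
  its unique solvability). [`Temam1997`]
* A. J. Majda, A. L. Bertozzi, *Vorticity and Incompressible Flow*, CUP 2002, §3.1.1, Prop. 3.1
  and Cor. 3.1 (the basic energy estimate and Grönwall). [`MajdaBertozziCUP2002`]
-/

open MeasureTheory Set Filter
open scoped InnerProductSpace ContDiff Topology

noncomputable section

namespace Literature.Analysis.FunctionSpaces

namespace Torus

variable {d : Type*} [Fintype d] [DecidableEq d]

/-! ## Spatial estimates -/

section Spatial

/-- **The production term is controlled by the velocity gradient.** For smooth fields
`v, w : T^d → ℝ^d` with `‖∂ᵢv(x)‖ ≤ Cᵢ` on `T^d`,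
`|∫ ⟪(w·∇)v, w⟫| ≤ (∑ᵢ Cᵢ) ∫ ‖w‖²` (`(w·∇)v = ∑ᵢ wᵢ ∂ᵢv`,
`Torus.fderiv_apply_eq_sum_partialDeriv`, and Cauchy–Schwarz pointwise). [folklore] -/
theorem abs_integral_inner_convect_le {v w : UnitAddTorus d → EuclideanSpace ℝ d}
    (hv : IsSmooth v) (hw : IsSmooth w) {C : d → ℝ} (hC : ∀ i x, ‖partialDeriv i v x‖ ≤ C i) :
    |∫ x, ⟪convect w v x, w x⟫_ℝ| ≤ (∑ i, C i) * ∫ x, ‖w x‖ ^ 2 := by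
  set L : ℝ := ∑ i, C i with hL_def
  have hpw : ∀ x, |⟪convect w v x, w x⟫_ℝ| ≤ L * ‖w x‖ ^ 2 := by
    intro x
    have hconv : convect w v x = ∑ i, w x i • partialDeriv i v x :=
      fderiv_apply_eq_sum_partialDeriv (hv.isContDiff (by simp)) x (w x)
    have hnorm : ‖convect w v x‖ ≤ L * ‖w x‖ := by
      rw [hconv, hL_def, Finset.sum_mul]
      refine (norm_sum_le _ _).trans (Finset.sum_le_sum fun i _ => ?_)
      rw [norm_smul]
      calc ‖w x i‖ * ‖partialDeriv i v x‖ ≤ ‖w x‖ * C i :=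
            mul_le_mul (PiLp.norm_apply_le (w x) i) (hC i x) (norm_nonneg _) (norm_nonneg _)
        _ = C i * ‖w x‖ := mul_comm _ _
    calc |⟪convect w v x, w x⟫_ℝ| ≤ ‖convect w v x‖ * ‖w x‖ := abs_real_inner_le_norm _ _
      _ ≤ L * ‖w x‖ * ‖w x‖ := by gcongr
      _ = L * ‖w x‖ ^ 2 := by ring
  rw [← integral_const_mul]
  refine abs_integral_le_integral_abs.trans (integral_mono_of_nonneg ?_ ?_ ?_)
  · exact Eventually.of_forall fun x => abs_nonneg _
  · exact (hw.norm_sq.integrable).const_mul L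
  · exact Eventually.of_forall hpw

/-- `∫ ⟪Δw, w⟫ = −‖∇w‖₂²` (`Torus.gradNormSq`) for a smooth real vector field on `T^d` (Green's
first identity, `Torus.integral_inner_laplacian_eq_neg_holds`). [folklore] -/
theorem integral_inner_laplacian_self_eq_neg_gradNormSq_of_isSmooth
    {w : UnitAddTorus d → EuclideanSpace ℝ d} (hw : IsSmooth w) :
    ∫ x, ⟪laplacian w x, w x⟫_ℝ = -gradNormSq w := by
  have hcomm : ∫ x, ⟪laplacian w x, w x⟫_ℝ = ∫ x, ⟪w x, laplacian w x⟫_ℝ :=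
    integral_congr_ae (ae_of_all _ fun x => real_inner_comm _ _)
  rw [hcomm, integral_inner_laplacian_eq_neg_holds hw, gradNormSq,
    integral_finsetSum _ fun i _ => ((hw.partialDeriv i).norm_sq).integrable]

/-- **The energy flux of the linearised equation is bounded by the energy.** For `ν ≥ 0`, smooth
`v, w : T^d → ℝ^d` and bounds `‖∂ᵢv‖ ≤ Cᵢ`:
`−2ν‖∇w‖₂² − 2 ∫ ⟪(w·∇)v, w⟫ ≤ 2(∑ᵢ Cᵢ) ∫ ‖w‖²` (drop the dissipation,
`Torus.abs_integral_inner_convect_le`). [folklore] -/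
theorem linearisedNS_energy_flux_le {ν : ℝ} (hν : 0 ≤ ν) {v w : UnitAddTorus d → EuclideanSpace ℝ d}
    (hv : IsSmooth v) (hw : IsSmooth w) {C : d → ℝ} (hC : ∀ i x, ‖partialDeriv i v x‖ ≤ C i) :
    -(2 * ν * gradNormSq w) - 2 * ∫ x, ⟪convect w v x, w x⟫_ℝ ≤
      (2 * ∑ i, C i) * ∫ x, ‖w x‖ ^ 2 := by
  have h := (abs_le.1 (abs_integral_inner_convect_le hv hw hC)).1
  have hG : 0 ≤ ν * gradNormSq w := mul_nonneg hν (gradNormSq_nonneg w)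
  nlinarith [h, hG]

end Spatial

/-! ## The energy identity and Grönwall on a compact time interval -/

section Energy

variable {a b ν : ℝ} {u w : ℝ → UnitAddTorus d → EuclideanSpace ℝ d}
  {q : ℝ → UnitAddTorus d → ℝ}

/-- **Energy identity for the linearised Navier–Stokes equation.** Let `u` be jointly smooth on
`[a, b] × T^d` (`a < b`) with divergence-free slices, and let `(w, q)` be jointly smooth with
`div w(t) = 0` and `∂ₜw + (u·∇)w + (w·∇)u = νΔw − ∇q` pointwise on `[a, b] × T^d` (one-sided time
derivative within `[a, b]`). Then `t ↦ ∫ ‖w(t)‖²` has the one-sided derivative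
`−2ν ‖∇w(t)‖₂² − 2 ∫ ⟪(w·∇)u, w⟫(t)` within `[a, b]`: differentiate under the integral,
`∂ₜ‖w‖² = 2⟪∂ₜw, w⟫`, insert the equation; the transport term `∫ ⟪(u·∇)w, w⟫` vanishes because
`div u = 0`, the pressure term because `div w = 0`, and `∫ ⟪Δw, w⟫ = −‖∇w‖₂²` (the "first energy
equation" of the linearised problem, Constantin–Foias 1988, Ch. 14, for (14.3)–(14.4); Temam 1997,
Ch. VI, (3.7)–(3.8)). [cite: ConstantinFoiasNSE1988, Ch. 14 (14.3)–(14.4)] -/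
theorem linearisedNS_hasDerivWithinAt_integral_norm_sq
    (hu : IsSmoothSpaceTimeOn (Icc a b) u) (hudiv : ∀ t ∈ Icc a b, IsDivFree (u t))
    (hw : IsSmoothSpaceTimeOn (Icc a b) w) (hq : IsSmoothSpaceTimeOn (Icc a b) q)
    (hwdiv : ∀ t ∈ Icc a b, IsDivFree (w t))
    (hlin : ∀ t ∈ Icc a b, ∀ x, timeDerivWithin (Icc a b) w t x + convect (u t) (w t) x +
      convect (w t) (u t) x = ν • laplacian (w t) x - gradient (q t) x)
    (hab : a < b) {t : ℝ} (ht : t ∈ Icc a b) :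
    HasDerivWithinAt (fun s => ∫ x, ‖w s x‖ ^ 2)
      (-(2 * ν * gradNormSq (w t)) - 2 * ∫ x, ⟪convect (w t) (u t) x, w t x⟫_ℝ) (Icc a b) t := by
  have hU : UniqueDiffOn ℝ (Icc a b) := uniqueDiffOn_Icc hab
  have hwt : IsSmooth (w t) := hw.isSmooth_slice ht
  have hut : IsSmooth (u t) := hu.isSmooth_slice ht
  have hqt : IsSmooth (q t) := hq.isSmooth_slice ht
  -- differentiate under the integral sign
  have hφ : IsSmoothSpaceTimeOn (Icc a b) (fun s x => ‖w s x‖ ^ 2) := by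
    change ContDiffOn ℝ ∞ (fun z => ‖stLift w z‖ ^ 2) (Icc a b ×ˢ univ)
    exact hw.norm_sq ℝ
  refine (hφ.hasDerivWithinAt_integral (convex_Icc a b) ht).congr_deriv ?_
  -- `∂ₜ‖w‖² = 2⟪∂ₜw, w⟫`
  have hpt : ∀ x, timeDerivWithin (Icc a b) (fun s x => ‖w s x‖ ^ 2) t x =
      2 * ⟪timeDerivWithin (Icc a b) w t x, w t x⟫_ℝ := by
    intro x
    have h2 := ((hw.hasDerivWithinAt_slice ht x).norm_sq).derivWithin (hU t ht)
    rw [real_inner_comm] at h2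
    exact h2
  -- the equation for `∂ₜw`
  have hderiv : ∀ x, timeDerivWithin (Icc a b) w t x =
      ν • laplacian (w t) x - gradient (q t) x -
        (convect (u t) (w t) x + convect (w t) (u t) x) := by
    intro x
    rw [← hlin t ht x]
    abel
  -- integrability of the four terms
  have hi0 : Integrable (fun x => ⟪laplacian (w t) x, w t x⟫_ℝ) volume :=
    (hwt.laplacian.inner hwt).integrable
  have hi1 : Integrable (fun x => ⟪convect (u t) (w t) x, w t x⟫_ℝ) volume :=
    ((hut.convect hwt).inner hwt).integrable
  have hi2 : Integrable (fun x => ⟪convect (w t) (u t) x, w t x⟫_ℝ) volume :=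
    ((hwt.convect hut).inner hwt).integrable
  have hi3 : Integrable (fun x => ⟪gradient (q t) x, w t x⟫_ℝ) volume :=
    (hqt.gradient.inner hwt).integrable
  have hi12 : Integrable (fun x => ⟪convect (u t) (w t) x, w t x⟫_ℝ +
      ⟪convect (w t) (u t) x, w t x⟫_ℝ) volume := hi1.add hi2
  have hiν : Integrable (fun x => ν * ⟪laplacian (w t) x, w t x⟫_ℝ) volume := hi0.const_mul ν
  have hiνq : Integrable (fun x => ν * ⟪laplacian (w t) x, w t x⟫_ℝ -
      ⟪gradient (q t) x, w t x⟫_ℝ) volume := hiν.sub hi3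
  have hiF : Integrable (fun x => ν * ⟪laplacian (w t) x, w t x⟫_ℝ -
      ⟪gradient (q t) x, w t x⟫_ℝ - (⟪convect (u t) (w t) x, w t x⟫_ℝ +
        ⟪convect (w t) (u t) x, w t x⟫_ℝ)) volume := hiνq.sub hi12
  simp_rw [hpt, hderiv, inner_sub_left, inner_add_left, real_inner_smul_left]
  rw [integral_const_mul, integral_sub hiνq hi12, integral_sub hiν hi3, integral_const_mul,
    integral_add hi1 hi2, integral_inner_convect_self_right_eq_zero hut (hudiv t ht) hwt,
    integral_inner_gradient_eq_zero_of_isDivFree hwt hqt (hwdiv t ht),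
    integral_inner_laplacian_self_eq_neg_gradNormSq_of_isSmooth hwt]
  ring

/-- **Continuous dependence in `L²` for the linearised equation (Grönwall).** Under the
hypotheses of `Torus.linearisedNS_hasDerivWithinAt_integral_norm_sq`, for `ν ≥ 0` and bounds
`‖∂ᵢu(t, x)‖ ≤ Cᵢ` on `[a, b] × T^d`,
`∫ ‖w(t)‖² ≤ (∫ ‖w(a)‖²) · exp(2(∑ᵢ Cᵢ)(t − a))` for all `t ∈ [a, b]`
(the energy inequality `E' ≤ 2(∑ᵢ Cᵢ) E`, `Torus.linearisedNS_energy_flux_le`, and Grönwall's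
lemma, Mathlib `le_gronwallBound_of_liminf_deriv_right_le`; Majda–Bertozzi 2002, Prop. 3.1 with
Lemma 3.1). Forward in time only. No hypothesis `a < b` (for `b ≤ a` the claim is at `t = a`).
[cite: MajdaBertozziCUP2002, Prop. 3.1 and Lemma 3.1] -/
theorem linearisedNS_integral_norm_sq_le_mul_exp (hν : 0 ≤ ν)
    (hu : IsSmoothSpaceTimeOn (Icc a b) u) (hudiv : ∀ t ∈ Icc a b, IsDivFree (u t))
    (hw : IsSmoothSpaceTimeOn (Icc a b) w) (hq : IsSmoothSpaceTimeOn (Icc a b) q)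
    (hwdiv : ∀ t ∈ Icc a b, IsDivFree (w t))
    (hlin : ∀ t ∈ Icc a b, ∀ x, timeDerivWithin (Icc a b) w t x + convect (u t) (w t) x +
      convect (w t) (u t) x = ν • laplacian (w t) x - gradient (q t) x)
    {C : d → ℝ} (hC : ∀ i, ∀ t ∈ Icc a b, ∀ x, ‖partialDeriv i (u t) x‖ ≤ C i)
    {t : ℝ} (ht : t ∈ Icc a b) :
    ∫ x, ‖w t x‖ ^ 2 ≤ (∫ x, ‖w a x‖ ^ 2) * Real.exp ((2 * ∑ i, C i) * (t - a)) := by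
  rcases lt_or_ge a b with hab | hba
  · set E : ℝ → ℝ := fun s => ∫ x, ‖w s x‖ ^ 2 with hE_def
    set E' : ℝ → ℝ := fun s => -(2 * ν * gradNormSq (w s)) -
      2 * ∫ x, ⟪convect (w s) (u s) x, w s x⟫_ℝ with hE'_def
    have hE : ∀ s ∈ Icc a b, HasDerivWithinAt E (E' s) (Icc a b) s := fun s hs =>
      linearisedNS_hasDerivWithinAt_integral_norm_sq hu hudiv hw hq hwdiv hlin hab hs
    have hE'le : ∀ s ∈ Icc a b, E' s ≤ (2 * ∑ i, C i) * E s := fun s hs =>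
      linearisedNS_energy_flux_le hν (hu.isSmooth_slice hs) (hw.isSmooth_slice hs)
        fun i x => hC i s hs x
    have hEc : ContinuousOn E (Icc a b) := fun s hs => (hE s hs).continuousWithinAt
    have hder : ∀ s ∈ Ico a b, HasDerivWithinAt E (E' s) (Ici s) s := fun s hs =>
      ((hE s (Ico_subset_Icc_self hs)).mono (Icc_subset_Icc hs.1 le_rfl)).mono_of_mem_nhdsWithin
        (Icc_mem_nhdsGE hs.2)
    have hgr := le_gronwallBound_of_liminf_deriv_right_le (f := E) (f' := E') (δ := E a)
      (K := 2 * ∑ i, C i) (ε := 0) (a := a) (b := b) hEc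
      (fun s hs r hr => (hder s hs).liminf_right_slope_le hr) le_rfl
      (fun s hs => by
        rw [add_zero]
        exact hE'le s (Ico_subset_Icc_self hs)) t ht
    rwa [gronwallBound_ε0] at hgr
  · have hta : t = a := le_antisymm (ht.2.trans hba) ht.1
    rw [hta, sub_self, mul_zero, Real.exp_zero, mul_one]

/-- **Zero datum gives the zero solution.** A linearised solution `(w, q)` along `u` on
`[a, b] × T^d` (hypotheses of `Torus.linearisedNS_hasDerivWithinAt_integral_norm_sq`, `ν ≥ 0`)
with `w(a) = 0` has `w(t) = 0` for all `t ∈ [a, b]`: bound `‖∂ᵢu‖` on the compact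
`[a, b] × T^d` (`Torus.IsSmoothSpaceTimeOn.exists_norm_le_of_isCompact`) and apply the Grönwall
bound (Constantin–Foias 1988, Ch. 14, after (14.6): "if `S'(s, u₀)ξ = 0` for some `s > 0` it
will remain zero for all `τ ≥ s`"). [cite: ConstantinFoiasNSE1988, Ch. 14 (14.6)] -/
theorem linearisedNS_eq_zero (hν : 0 ≤ ν)
    (hu : IsSmoothSpaceTimeOn (Icc a b) u) (hudiv : ∀ t ∈ Icc a b, IsDivFree (u t))
    (hw : IsSmoothSpaceTimeOn (Icc a b) w) (hq : IsSmoothSpaceTimeOn (Icc a b) q)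
    (hwdiv : ∀ t ∈ Icc a b, IsDivFree (w t))
    (hlin : ∀ t ∈ Icc a b, ∀ x, timeDerivWithin (Icc a b) w t x + convect (u t) (w t) x +
      convect (w t) (u t) x = ν • laplacian (w t) x - gradient (q t) x)
    (h0 : w a = 0) {t : ℝ} (ht : t ∈ Icc a b) : w t = 0 := by
  classical
  rcases lt_or_ge a b with hab | hba
  · have hU : UniqueDiffOn ℝ (Icc a b) := uniqueDiffOn_Icc hab
    obtain ⟨C, hC⟩ : ∃ C : d → ℝ, ∀ i, ∀ s ∈ Icc a b, ∀ x, ‖partialDeriv i (u s) x‖ ≤ C i := by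
      have hbd : ∀ i : d, ∃ c : ℝ, ∀ s ∈ Icc a b, ∀ x, ‖partialDeriv i (u s) x‖ ≤ c := fun i =>
        (hu.partialDeriv hU i).exists_norm_le_of_isCompact isCompact_Icc subset_rfl
      choose C hC using hbd
      exact ⟨C, hC⟩
    have h := linearisedNS_integral_norm_sq_le_mul_exp hν hu hudiv hw hq hwdiv hlin hC ht
    have hzero : ∫ x, ‖w a x‖ ^ 2 = 0 := by simp [h0]
    rw [hzero, zero_mul] at h
    exact eq_zero_of_integral_norm_sq_nonpos (hw.isSmooth_slice ht) h
  · have hta : t = a := le_antisymm (ht.2.trans hba) ht.1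
    rw [hta, h0]

variable {w₁ w₂ : ℝ → UnitAddTorus d → EuclideanSpace ℝ d} {q₁ q₂ : ℝ → UnitAddTorus d → ℝ}

/-- **Linearity: the difference of two linearised solutions is a linearised solution.** If
`(w₁, q₁)` and `(w₂, q₂)` solve the linearised equation along the same field `u` on
`[a, b] × T^d`, `a < b`, then so does `(w₁ − w₂, q₁ − q₂)`: the one-sided time derivative, the
transport term `(u·∇)w`, the production term `(w·∇)u`, `Δ` and `∇` are all linear in `(w, q)`
(`HasDerivWithinAt.sub`, `Torus.fderiv_sub`, `map_sub`, `Torus.laplacian_sub`,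
`Torus.gradient_sub`). [folklore] -/
theorem linearisedNS_sub_eq
    (hw₁ : IsSmoothSpaceTimeOn (Icc a b) w₁) (hq₁ : IsSmoothSpaceTimeOn (Icc a b) q₁)
    (hlin₁ : ∀ t ∈ Icc a b, ∀ x, timeDerivWithin (Icc a b) w₁ t x + convect (u t) (w₁ t) x +
      convect (w₁ t) (u t) x = ν • laplacian (w₁ t) x - gradient (q₁ t) x)
    (hw₂ : IsSmoothSpaceTimeOn (Icc a b) w₂) (hq₂ : IsSmoothSpaceTimeOn (Icc a b) q₂)
    (hlin₂ : ∀ t ∈ Icc a b, ∀ x, timeDerivWithin (Icc a b) w₂ t x + convect (u t) (w₂ t) x +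
      convect (w₂ t) (u t) x = ν • laplacian (w₂ t) x - gradient (q₂ t) x)
    (hab : a < b) {t : ℝ} (ht : t ∈ Icc a b) (x : UnitAddTorus d) :
    timeDerivWithin (Icc a b) (fun s y => w₁ s y - w₂ s y) t x +
        convect (u t) (fun y => w₁ t y - w₂ t y) x + convect (fun y => w₁ t y - w₂ t y) (u t) x =
      ν • laplacian (fun y => w₁ t y - w₂ t y) x - gradient (fun y => q₁ t y - q₂ t y) x := by
  have hU : UniqueDiffOn ℝ (Icc a b) := uniqueDiffOn_Icc hab
  have hs₁ : IsSmooth (w₁ t) := hw₁.isSmooth_slice ht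
  have hs₂ : IsSmooth (w₂ t) := hw₂.isSmooth_slice ht
  have hp₁ : IsContDiff 1 (q₁ t) := (hq₁.isSmooth_slice ht).isContDiff (by simp)
  have hp₂ : IsContDiff 1 (q₂ t) := (hq₂.isSmooth_slice ht).isContDiff (by simp)
  have hD : timeDerivWithin (Icc a b) (fun s y => w₁ s y - w₂ s y) t x =
      timeDerivWithin (Icc a b) w₁ t x - timeDerivWithin (Icc a b) w₂ t x :=
    ((hw₁.hasDerivWithinAt_slice ht x).sub (hw₂.hasDerivWithinAt_slice ht x)).derivWithin (hU t ht)
  have hw12 : (fun y => w₁ t y - w₂ t y) = w₁ t - w₂ t := rfl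
  have hq12 : (fun y => q₁ t y - q₂ t y) = q₁ t - q₂ t := rfl
  have hA : convect (u t) (fun y => w₁ t y - w₂ t y) x =
      convect (u t) (w₁ t) x - convect (u t) (w₂ t) x := by
    simp only [convect, hw12, fderiv_sub (hs₁.isContDiff (by simp)) (hs₂.isContDiff (by simp)),
      sub_apply]
  have hB : convect (fun y => w₁ t y - w₂ t y) (u t) x =
      convect (w₁ t) (u t) x - convect (w₂ t) (u t) x := by
    simp only [convect, map_sub]
  have hL : laplacian (fun y => w₁ t y - w₂ t y) x = laplacian (w₁ t) x - laplacian (w₂ t) x := by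
    rw [hw12, laplacian_sub hs₁ hs₂, Pi.sub_apply]
  have hG : gradient (fun y => q₁ t y - q₂ t y) x = gradient (q₁ t) x - gradient (q₂ t) x := by
    rw [hq12, gradient_sub hp₁ hp₂]
  rw [hD, hA, hB, hL, hG, smul_sub]
  have e₁ := eq_sub_of_add_eq (eq_sub_of_add_eq (hlin₁ t ht x))
  have e₂ := eq_sub_of_add_eq (eq_sub_of_add_eq (hlin₂ t ht x))
  rw [e₁, e₂]
  abel

/-- **Uniqueness for the linearised Navier–Stokes equation on a compact time interval.** Two
linearised solutions `(w₁, q₁)`, `(w₂, q₂)` along the same smooth divergence-free field `u` on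
`[a, b] × T^d` (`ν ≥ 0`) with `w₁(a) = w₂(a)` have `w₁ = w₂` on `[a, b]` (linearity,
`Torus.linearisedNS_sub_eq`, and `Torus.linearisedNS_eq_zero`; Temam 1997, Ch. VI, (3.11): the
linearised problem (3.7)–(3.10) "possesses a unique solution"; Constantin–Foias 1988, Ch. 14,
"the uniqueness of solutions of (14.3)"). [cite: Temam1997, Ch. VI §3.1 (3.11)] -/
theorem linearisedNS_unique (hν : 0 ≤ ν)
    (hu : IsSmoothSpaceTimeOn (Icc a b) u) (hudiv : ∀ t ∈ Icc a b, IsDivFree (u t))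
    (hw₁ : IsSmoothSpaceTimeOn (Icc a b) w₁) (hq₁ : IsSmoothSpaceTimeOn (Icc a b) q₁)
    (hwdiv₁ : ∀ t ∈ Icc a b, IsDivFree (w₁ t))
    (hlin₁ : ∀ t ∈ Icc a b, ∀ x, timeDerivWithin (Icc a b) w₁ t x + convect (u t) (w₁ t) x +
      convect (w₁ t) (u t) x = ν • laplacian (w₁ t) x - gradient (q₁ t) x)
    (hw₂ : IsSmoothSpaceTimeOn (Icc a b) w₂) (hq₂ : IsSmoothSpaceTimeOn (Icc a b) q₂)
    (hwdiv₂ : ∀ t ∈ Icc a b, IsDivFree (w₂ t))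
    (hlin₂ : ∀ t ∈ Icc a b, ∀ x, timeDerivWithin (Icc a b) w₂ t x + convect (u t) (w₂ t) x +
      convect (w₂ t) (u t) x = ν • laplacian (w₂ t) x - gradient (q₂ t) x)
    (h0 : w₁ a = w₂ a) {t : ℝ} (ht : t ∈ Icc a b) : w₁ t = w₂ t := by
  rcases lt_or_ge a b with hab | hba
  · have hdiv : ∀ s ∈ Icc a b, IsDivFree (fun y => w₁ s y - w₂ s y) := by
      intro s hs x
      have h12 : (fun y => w₁ s y - w₂ s y) = w₁ s - w₂ s := rfl
      rw [h12, divergence_sub ((hw₁.isSmooth_slice hs).isContDiff (by simp))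
        ((hw₂.isSmooth_slice hs).isContDiff (by simp)), hwdiv₁ s hs x, hwdiv₂ s hs x, sub_zero]
    have hz := linearisedNS_eq_zero hν hu hudiv (hw₁.sub hw₂) (hq₁.sub hq₂) hdiv
      (fun s hs x => linearisedNS_sub_eq hw₁ hq₁ hlin₁ hw₂ hq₂ hlin₂ hab hs x)
      (by funext y; simp [h0]) ht
    funext y
    exact sub_eq_zero.1 (congrFun hz y)
  · have hta : t = a := le_antisymm (ht.2.trans hba) ht.1
    rw [hta, h0]

end Energy

end Torus

end Literature.Analysis.FunctionSpaces
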